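import Mathlib.MeasureTheory.Integral.Pi
import Mathlib.MeasureTheory.Integral.Prod
import HarnessLib

/-!
# Peeling path integrals of a transfer kernel over a block of sites (Markov property in `Fin` form)

Topic `Literature/Analysis/OperatorTheory`; companion of `PositiveKernelTransferOperator.lean` (the
transfer operator `(Aφ)(x) = ∫ K(x,y) φ(y) dρ(y)` on `L²(ρ)`) and `PowerIterationRatioLimit.lean`. For
a bounded measurable kernel `K` on a FINITE measure space `(Y, ρ)`, the un-normalised weight of a path
`ζ : Fin M → Y` of spins attached to a left boundary spin `u` is
`W(u, ζ) = ∏_{i : Fin M} K((u ∷ ζ)_{i}, ζ_i)` (`u ∷ ζ = Fin.cons u ζ`; the `i`-th factor couples site `i`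
to its left neighbour). This file PROVES the Markov/peeling identities that turn block integrals of such
weights into iterates of the function-level transfer operator `(κ f)(x) = ∫ K(x, y) f(y) dρ(y)`:

* `measurable_finCons`, `measurable_pathWeight`, `norm_pathWeight_le` — bookkeeping (`|W| ≤ C^M`);
* `integral_pathWeight_succ_eq` — ONE-STEP PEELING:
  `∫ W(u,ζ) F(ζ) dρ^{⊗(M+1)}(ζ) = ∫ K(u,y) [∫ W(y,ζ') F(y ∷ ζ') dρ^{⊗M}(ζ')] dρ(y)` for bounded
  measurable `F` (Fubini along `Fin.cons`, Mathlib `measurePreserving_piFinSuccAbove _ 0`);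
* `integral_pathWeight_eq_iterate` — `j`-FOLD PEELING: if the observable depends only on the last
  `n` of `n + j` sites, `∫ W(u,ζ) G(ζ|_{last n}) dρ^{⊗(n+j)} = (κ^j h)(u)` with
  `h(x) = ∫ W(x,ζ') G(ζ') dρ^{⊗n}(ζ')`.

With the `L²` realisation `A` of `κ` (`exists_kernelOp`: `A[f] =ᵐ κ f`) this expresses finite-volume
Gibbs integrals of one-dimensional nearest-neighbour models with `j` sites between the boundary and the
observable as `⟪k_u, A^{j-1}[h]⟫`, the input of `exists_forall_abs_ratio_sub_lt`. Mathlib only, no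
definitions (the weight and `κ` are written out). [folklore]
-/

noncomputable section

open MeasureTheory Filter Set Function

namespace Literature.Analysis.OperatorTheory

variable {Y : Type*} [MeasurableSpace Y] {ρ : Measure Y} [IsFiniteMeasure ρ]
  {K : Y → Y → ℝ} {C : ℝ}

/-- `(y, ζ') ↦ y ∷ ζ'` is measurable. [folklore] -/
theorem measurable_finCons (M : ℕ) :
    Measurable fun p : Y × (Fin M → Y) => (Fin.cons p.1 p.2 : Fin (M + 1) → Y) := by
  refine measurable_pi_iff.2 (Fin.cases ?_ (fun j => ?_))
  · simp only [Fin.cons_zero]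
    exact measurable_fst
  · simp only [Fin.cons_succ]
    exact (measurable_pi_apply j).comp measurable_snd

/-- Measurability of the path weight `ζ ↦ ∏ᵢ K((u ∷ ζ)ᵢ, ζᵢ)` of a block of `M` sites with left
boundary spin `u`, jointly in `(u, ζ)`. [folklore] -/
theorem measurable_pathWeight (hK : Measurable (uncurry K)) (M : ℕ) :
    Measurable fun p : Y × (Fin M → Y) =>
      ∏ i : Fin M, K ((Fin.cons p.1 p.2 : Fin (M + 1) → Y) (Fin.castSucc i)) (p.2 i) := by
  refine Finset.measurable_prod _ fun i _ => ?_
  have h1 : Measurable fun p : Y × (Fin M → Y) => (Fin.cons p.1 p.2 : Fin (M + 1) → Y) (Fin.castSucc i) :=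
    (measurable_pi_apply _).comp (measurable_finCons M)
  have h2 : Measurable fun p : Y × (Fin M → Y) => p.2 i := (measurable_pi_apply i).comp measurable_snd
  exact hK.comp (h1.prodMk h2)

omit [MeasurableSpace Y] in
/-- The path weight is bounded by `C^M` when `|K| ≤ C`. [folklore] -/
theorem norm_pathWeight_le (hC : ∀ x y, ‖K x y‖ ≤ C) (M : ℕ) (u : Y) (ζ : Fin M → Y) :
    ‖∏ i : Fin M, K ((Fin.cons u ζ : Fin (M + 1) → Y) (Fin.castSucc i)) (ζ i)‖ ≤ C ^ M := by
  have hC0 : 0 ≤ C := (norm_nonneg _).trans (hC u u)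
  calc ‖∏ i : Fin M, K ((Fin.cons u ζ : Fin (M + 1) → Y) (Fin.castSucc i)) (ζ i)‖
      ≤ ∏ i : Fin M, ‖K ((Fin.cons u ζ : Fin (M + 1) → Y) (Fin.castSucc i)) (ζ i)‖ :=
        Finset.norm_prod_le _ _
    _ ≤ ∏ _i : Fin M, C := Finset.prod_le_prod (fun i _ => norm_nonneg _) fun i _ => hC _ _
    _ = C ^ M := by simp

/-- **One-step peeling (Markov property of the path weight).** For a bounded measurable kernel `K`
on a finite measure space, a block of `M + 1` sites with left boundary spin `u` and a bounded
measurable function `F` of the block,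
`∫ (∏ᵢ K((u∷ζ)ᵢ, ζᵢ)) F(ζ) dρ^{⊗(M+1)}(ζ) = ∫ K(u,y) [∫ (∏ᵢ K((y∷ζ')ᵢ, ζ'ᵢ)) F(y∷ζ') dρ^{⊗M}(ζ')] dρ(y)`:
the first site is integrated last (Fubini along `Fin.cons`, Mathlib `measurePreserving_piFinSuccAbove`).
[folklore] -/
theorem integral_pathWeight_succ_eq (hK : Measurable (uncurry K)) (hC : ∀ x y, ‖K x y‖ ≤ C) (M : ℕ)
    (u : Y) {F : (Fin (M + 1) → Y) → ℝ} (hF : Measurable F) {B : ℝ} (hFb : ∀ ζ, ‖F ζ‖ ≤ B) :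
    ∫ ζ : Fin (M + 1) → Y, (∏ i : Fin (M + 1),
        K ((Fin.cons u ζ : Fin (M + 2) → Y) (Fin.castSucc i)) (ζ i)) * F ζ ∂(Measure.pi fun _ => ρ) =
      ∫ y, K u y * ∫ ζ' : Fin M → Y, (∏ i : Fin M,
        K ((Fin.cons y ζ' : Fin (M + 1) → Y) (Fin.castSucc i)) (ζ' i)) *
          F (Fin.cons y ζ') ∂(Measure.pi fun _ => ρ) ∂ρ := by
  set pi : Measure (Fin M → Y) := Measure.pi fun _ => ρ with hpi
  have hmp := (measurePreserving_piFinSuccAbove (fun _ : Fin (M + 1) => ρ) 0).symm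
  -- the integrand transported to `Y × (Fin M → Y)`
  set G : (Fin (M + 1) → Y) → ℝ := fun ζ =>
    (∏ i : Fin (M + 1), K ((Fin.cons u ζ : Fin (M + 2) → Y) (Fin.castSucc i)) (ζ i)) * F ζ with hG
  have hcons : ∀ (y : Y) (ζ' : Fin M → Y),
      G (Fin.cons y ζ') = K u y * ((∏ i : Fin M,
        K ((Fin.cons y ζ' : Fin (M + 1) → Y) (Fin.castSucc i)) (ζ' i)) * F (Fin.cons y ζ')) := by
    intro y ζ'
    rw [hG]
    dsimp only
    rw [Fin.prod_univ_succ]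
    simp only [Fin.cons_zero, Fin.cons_succ, Fin.castSucc_zero, ← Fin.succ_castSucc]
    ring
  have he : ∀ p : Y × (Fin M → Y),
      (MeasurableEquiv.piFinSuccAbove (fun _ : Fin (M + 1) => Y) 0).symm p = Fin.cons p.1 p.2 := by
    intro p
    simp only [MeasurableEquiv.piFinSuccAbove_symm_apply, Fin.insertNthEquiv, Fin.insertNth_zero,
      Equiv.coe_fn_mk]
    rfl
  -- change of variables
  have h1 : ∫ ζ, G ζ ∂(Measure.pi fun _ : Fin (M + 1) => ρ) =
      ∫ p, G (Fin.cons p.1 p.2) ∂(ρ.prod pi) := by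
    rw [← hmp.integral_comp']
    refine integral_congr_ae (Eventually.of_forall fun p => ?_)
    dsimp only
    rw [he]
  rw [h1]
  -- Fubini
  have hcm : Measurable fun p : Y × (Fin M → Y) => (Fin.cons p.1 p.2 : Fin (M + 1) → Y) :=
    measurable_finCons M
  have hGm : Measurable G := by
    have hw := measurable_pathWeight hK (M + 1)
    exact (hw.comp (measurable_const.prodMk measurable_id)).mul hF
  have hC0 : 0 ≤ C := (norm_nonneg _).trans (hC u u)
  have hB0 : 0 ≤ B := (norm_nonneg _).trans (hFb (Fin.cons u fun _ => u))
  have hGb : ∀ ζ, ‖G ζ‖ ≤ C ^ (M + 1) * B := fun ζ => by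
    rw [hG]; dsimp only; rw [norm_mul]
    exact mul_le_mul (norm_pathWeight_le hC (M + 1) u ζ) (hFb ζ) (norm_nonneg _) (by positivity)
  have hint : Integrable (fun p : Y × (Fin M → Y) => G (Fin.cons p.1 p.2)) (ρ.prod pi) := by
    have hmeas : AEStronglyMeasurable (fun p : Y × (Fin M → Y) => G (Fin.cons p.1 p.2)) (ρ.prod pi) :=
      (hGm.comp hcm).aestronglyMeasurable
    exact memLp_one_iff_integrable.1
      (MemLp.of_bound hmeas (C ^ (M + 1) * B) (Eventually.of_forall fun p => hGb _))
  rw [integral_prod _ hint]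
  refine integral_congr_ae (Eventually.of_forall fun y => ?_)
  dsimp only
  simp_rw [hcons]
  rw [integral_const_mul]


/-- **Peeling `j` sites: the path integral is the `j`-th iterate of the kernel** (Markov property,
iterated). For a block of `n + j` sites with left boundary spin `u` whose observable `G` only depends
on the LAST `n` sites, integrating out the first `j` sites one by one gives
`∫ (∏ᵢ K((u∷ζ)ᵢ, ζᵢ)) G(ζ|_{last n}) dρ^{⊗(n+j)} = (κ^j h)(u)`, where `(κ f)(x) = ∫ K(x,y) f(y) dρ(y)` and
`h(x) = ∫ (∏ᵢ K((x∷ζ')ᵢ, ζ'ᵢ)) G(ζ') dρ^{⊗n}(ζ')` is the same integral over the last `n` sites with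
boundary spin `x` — the block analogue of "`K^{(j)}(u, ·) = κ^{j-1} K(u, ·)`" for iterated transfer
kernels. [folklore] -/
theorem integral_pathWeight_eq_iterate (hK : Measurable (uncurry K)) (hC : ∀ x y, ‖K x y‖ ≤ C)
    (n : ℕ) {G : (Fin n → Y) → ℝ} (hG : Measurable G) {B : ℝ} (hGb : ∀ ζ, ‖G ζ‖ ≤ B) (j : ℕ) (u : Y) :
    ∫ ζ : Fin (n + j) → Y, (∏ i : Fin (n + j),
        K ((Fin.cons u ζ : Fin (n + j + 1) → Y) (Fin.castSucc i)) (ζ i)) * G (fun i => ζ (i.addNat j))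
        ∂(Measure.pi fun _ => ρ) =
      (fun f : Y → ℝ => fun x => ∫ y, K x y * f y ∂ρ)^[j]
        (fun x => ∫ ζ' : Fin n → Y, (∏ i : Fin n,
          K ((Fin.cons x ζ' : Fin (n + 1) → Y) (Fin.castSucc i)) (ζ' i)) * G ζ'
          ∂(Measure.pi fun _ => ρ)) u := by
  induction j generalizing u with
  | zero =>
    simp only [Function.iterate_zero, id_eq]
    rfl
  | succ j ih =>
    have hFm : Measurable fun ζ : Fin (n + j + 1) → Y => G fun i => ζ (i.addNat (j + 1)) :=
      hG.comp (measurable_pi_lambda _ fun i => measurable_pi_apply _)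
    have h1 := integral_pathWeight_succ_eq (ρ := ρ) hK hC (n + j) u (F := fun ζ : Fin (n + j + 1) → Y =>
      G fun i => ζ (i.addNat (j + 1))) hFm (fun ζ => hGb _)
    rw [Function.iterate_succ_apply']
    refine h1.trans ?_
    refine integral_congr_ae (Eventually.of_forall fun y => ?_)
    dsimp only
    -- `(y ∷ ζ') (i.addNat (j+1)) = ζ' (i.addNat j)` holds by computation, so `congr` closes it
    rw [← ih y]
    congr 1

end Literature.Analysis.OperatorTheory

end
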